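import Mathlib

/-!
# O-D — the (U1)/(U2) lemma of `pub-hubbard-dualstruct/d3za/U-CHORD-g21.md` in ABSTRACT form (dualstruct-1 g22, for lit's queue on LEAD g31's word l.5088 R6-3 (iii))
HONEST FRAMING: ladder R1–R4 with certified numbers; no claim on H/H₀. Pure real analysis, no Hubbard object, no numerics.
Dictionary: `ι` = states (or pseudo-states of a relaxation whose rows are U-free), `a s + U * b s` = ⟨T⟩_s + U·⟨D⟩_s with
`b s = ⟨D⟩_s ≥ 0` (double occupancy), `E U` = the exact infimum (ground-state energy e_L(U), or the relaxation value v_L(U)).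
(U1): a certified floor at `U₀` is a floor at every `U ≥ U₀`.  (U2): floors at `Ua`, `Ub` give the CHORD floor at every
`U_t = (1-t)•Ua + t•Ub`, because an infimum of maps affine in `U` is concave.  The certificate-level statement of g21
((y,Ω) convex combinations on the union row set) implies these and is not needed by the assembler's U-explicit column.
FILER NOTE (lit g35): author bytes `pub-hubbard-dualstruct/d3zb/add1/UChordAbstract.lean` sha256 81d1bb9b1fb9dcc2…
(dualstruct-1 g22, INBOX l.5099); re-homed into the tree namespace `Summit.HubbardSuperconductivity.HubbardLadder.UChord`
(2 lines changed: `namespace` / `end`); every statement and proof byte unchanged.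
-/

namespace Summit.HubbardSuperconductivity.HubbardLadder.UChord

/-- `E` is the exact infimum over a family of costs affine in the coupling `U` with nonnegative slopes. -/
structure IsInfAffine {ι : Type*} (E : ℝ → ℝ) (a b : ι → ℝ) : Prop where
  slope_nonneg : ∀ s, 0 ≤ b s
  glb : ∀ U, IsGLB (Set.range fun s => a s + U * b s) (E U)

variable {ι : Type*} {E : ℝ → ℝ} {a b : ι → ℝ}

/-- (U1) MONOTONE EXTENSION: `v ≤ E U₀` and `U₀ ≤ U` give `v ≤ E U`. -/
theorem floor_mono (h : IsInfAffine E a b) {U₀ U v : ℝ} (hU : U₀ ≤ U) (hv : v ≤ E U₀) : v ≤ E U := by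
  refine hv.trans ((h.glb U).2 ?_)
  rintro x ⟨s, rfl⟩
  have h0 : E U₀ ≤ a s + U₀ * b s := (h.glb U₀).1 ⟨s, rfl⟩
  nlinarith [h.slope_nonneg s]

/-- (U2) U-CHORD: floors `va ≤ E Ua`, `vb ≤ E Ub` give `(1-t) va + t vb ≤ E ((1-t) Ua + t Ub)` for `t ∈ [0,1]`. -/
theorem floor_chord (h : IsInfAffine E a b) {Ua Ub va vb t : ℝ} (ht0 : 0 ≤ t) (ht1 : t ≤ 1)
    (ha : va ≤ E Ua) (hb : vb ≤ E Ub) : (1 - t) * va + t * vb ≤ E ((1 - t) * Ua + t * Ub) := by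
  refine (h.glb _).2 ?_
  rintro x ⟨s, rfl⟩
  have h1 : E Ua ≤ a s + Ua * b s := (h.glb Ua).1 ⟨s, rfl⟩
  have h2 : E Ub ≤ a s + Ub * b s := (h.glb Ub).1 ⟨s, rfl⟩
  nlinarith

/-- Corollary used by the U-explicit column: with anchors `Ua < Ub`, every `U ∈ [Ua, Ub]` inherits the chord floor. -/
theorem floor_on_interval (h : IsInfAffine E a b) {Ua Ub va vb U : ℝ} (hab : Ua < Ub) (hU : U ∈ Set.Icc Ua Ub)
    (ha : va ≤ E Ua) (hb : vb ≤ E Ub) : va + (U - Ua) * (vb - va) / (Ub - Ua) ≤ E U := by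
  have hd : 0 < Ub - Ua := sub_pos.mpr hab
  set t := (U - Ua) / (Ub - Ua) with ht
  have ht0 : 0 ≤ t := div_nonneg (sub_nonneg.mpr hU.1) hd.le
  have ht1 : t ≤ 1 := (div_le_one hd).mpr (by linarith [hU.2])
  have hUt : (1 - t) * Ua + t * Ub = U := by rw [ht]; field_simp; ring
  have key := floor_chord h ht0 ht1 ha hb
  rw [hUt] at key
  have : (1 - t) * va + t * vb = va + (U - Ua) * (vb - va) / (Ub - Ua) := by rw [ht]; field_simp; ring
  linarith [this]

end Summit.HubbardSuperconductivity.HubbardLadder.UChord
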